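import Summits.AtomisticToContinuum.Crystallization.Theses.GappedShellCensus
import Literature.Geometry.DiscreteGeometry.DihedralAngleFraction

/-!
# Stub `stub_tfEmptySector` — the empty azimuthal sector of a torn bond
# (crux `GappedShellCensus.TornFree`, stmt-AtomisticToContinuum-18069, line `Sketch`)

Metric form of the planar pigeonhole for three vectors.  Assuming the pigeonhole (the hypothesis:
three vectors `q i` orthogonal to `b ≠ 0` leave a unit `e ⊥ b` at angle `≥ 60°` from each of them,
`⟪q i, e⟫ ≤ ‖q i‖ / 2`), a finite set `C` of at most three points about a segment `[y, v]` (`v ≠ y`)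
leaves a unit direction `e ⊥ v − y` with `⟪w − y, e⟫ ≤ ‖perpTo (v − y) (w − y)‖ / 2` for every
`w ∈ C`: every point of `C` is at azimuth `≥ 60°` from `e` about the axis `v − y` — an empty
azimuthal sector of opening `120°` about the bond.

Proof: enumerate `C` by `Fin 3` (`Set.Finite.fin_embedding`, padding with `y`), apply the
hypothesis to the components `q i = perpTo (v − y) (wᵢ − y)` orthogonal to the axis
(`inner_perpTo_left`), and split `w − y = perpTo (v − y) (w − y) + c • (v − y)` (`perpTo_add_smul`):
pairing with `e ⊥ v − y` only sees the perpendicular component.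

`perpTo` is `Literature.Geometry.DiscreteGeometry.perpTo` (`DihedralAngleFraction.lean`).  No named
facts, no new definitions.
-/

noncomputable section

namespace Summit.AtomisticToContinuum.Crystallization.Theorems

open Literature.Geometry.DiscreteGeometry
open scoped RealInnerProductSpace

/-- A finite set of at most three points is covered by the values of a map out of `Fin 3`
(enumerate by `Set.Finite.fin_embedding`, pad with `y`). -/
private theorem tfEmptySector_enum {C : Set (EuclideanSpace ℝ (Fin 3))} (hC : C.Finite)
    (hC3 : C.ncard ≤ 3) (y : EuclideanSpace ℝ (Fin 3)) :
    ∃ w' : Fin 3 → EuclideanSpace ℝ (Fin 3), ∀ w ∈ C, ∃ i, w' i = w := by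
  obtain ⟨n, f, hf⟩ := hC.fin_embedding
  have hn : n ≤ 3 := by
    have h := Set.ncard_range_of_injective f.injective
    rw [hf, Nat.card_eq_fintype_card, Fintype.card_fin] at h
    omega
  refine ⟨fun i => if h : (i : ℕ) < n then f ⟨i, h⟩ else y, fun w hw => ?_⟩
  rw [← hf] at hw
  obtain ⟨k, rfl⟩ := hw
  exact ⟨⟨k, lt_of_lt_of_le k.2 hn⟩, by simp [k.2]⟩

/-- Along an axis `b`, a vector `x` is its component `perpTo b x` orthogonal to `b` plus a multiple
of `b`; pairing with a direction `e ⊥ b` only sees the orthogonal component. -/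
private theorem tfEmptySector_inner_eq (b x e : EuclideanSpace ℝ (Fin 3)) (heb : ⟪e, b⟫ = 0) :
    ⟪x, e⟫ = ⟪perpTo b x, e⟫ := by
  conv_lhs => rw [← perpTo_add_smul b x]
  rw [inner_add_left, real_inner_smul_left, real_inner_comm e b, heb, mul_zero, add_zero]

/-- **Stub 3 (empty sector of a torn bond).** From the planar pigeonhole for three vectors (the
hypothesis): at most three points `w` about a segment `[y, v]` leave a unit direction `e ⊥ v − y`
with every `w` at azimuth `≥ 60°` from `e`, i.e. `⟪w − y, e⟫ ≤ ‖perpTo (v − y) (w − y)‖ / 2` — an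
empty azimuthal sector of opening `120°` about the bond. [folklore] -/
theorem stub_tfEmptySector :
    (∀ b : EuclideanSpace ℝ (Fin 3), b ≠ 0 → ∀ q : Fin 3 → EuclideanSpace ℝ (Fin 3),
      (∀ i, ⟪q i, b⟫ = 0) →
      ∃ e : EuclideanSpace ℝ (Fin 3), ‖e‖ = 1 ∧ ⟪e, b⟫ = 0 ∧ ∀ i, ⟪q i, e⟫ ≤ 1 / 2 * ‖q i‖) →
    ∀ (C : Set (EuclideanSpace ℝ (Fin 3))) (y v : EuclideanSpace ℝ (Fin 3)), v ≠ y → C.Finite →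
      C.ncard ≤ 3 →
      ∃ e : EuclideanSpace ℝ (Fin 3), ‖e‖ = 1 ∧ ⟪e, v - y⟫ = 0 ∧
        ∀ w ∈ C, ⟪w - y, e⟫ ≤ 1 / 2 * ‖perpTo (v - y) (w - y)‖ := by
  intro hcirc C y v hvy hC hC3
  obtain ⟨w', hw'⟩ := tfEmptySector_enum hC hC3 y
  obtain ⟨e, he1, heb, hqe⟩ :=
    hcirc (v - y) (sub_ne_zero.mpr hvy) (fun i => perpTo (v - y) (w' i - y))
      fun i => inner_perpTo_left (v - y) (w' i - y)
  refine ⟨e, he1, heb, fun w hw => ?_⟩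
  obtain ⟨i, rfl⟩ := hw' w hw
  rw [tfEmptySector_inner_eq (v - y) (w' i - y) e heb]
  exact hqe i

end Summit.AtomisticToContinuum.Crystallization.Theorems

end
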